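import Literature.Analysis.FluidPDE.DivCurlLpRowEstimate
import Literature.Analysis.FluidPDE.BeiraoDaVeigaEnstrophyGronwall
import Literature.Analysis.FluidPDE.ConstantinFeffermanEnstrophySlab
import Literature.Analysis.FluidPDE.OseenHeatLpBounds
import HarnessLib

/-!
# Chae–Choe's stretching estimate: the vortex stretching is controlled by two components of
# the vorticity

search for candidate a priori estimates; no regularity claim (cell `pub-nsfunc`, literature seat:
a published estimate as a THEOREM; nothing new).

The fixed-time estimate of Chae–Choe's two-vorticity-components regularity criterion (Chae–Choe,
Electron. J. Differential Equations 1999 No. 05, proof of Thm. 1, (5)–(9)): for a smooth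
divergence-free field `v` on `ℝ³` with vorticity `ω = curl v`, a free index `k` and the two other
components `ω_{k+1}, ω_{k+2}` (indices mod `3`; the paper's `ω̃ = ω₁e₁ + ω₂e₂` is `k = 2`), and
`3/2 < γ < ∞`,
`2∫⟪ω, (∇v)ω⟫ ≤ ν ∫|∇ω|²_F + C (‖ω_{k+1}‖_{L^γ}^{q} + ‖ω_{k+2}‖_{L^γ}^{q}) ∫|ω|²`,
`q = 2γ/(2γ−3) = 1/(1 − 3/(2γ))`, `C = C(γ, ν)`.

Printed proof and the rendering here: in `(ω·∇)v·ω = Σᵢⱼ ωᵢωⱼ∂ⱼvᵢ` every term except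
`ω_k² ∂_kv_k` carries a factor `ω_{k+1}` or `ω_{k+2}` (the paper's decomposition (7): the
interaction of the `ω' = ω₃e₃` parts alone vanishes), so pointwise
`|⟪ω, (∇v)ω⟫| ≤ 2(|ω_{k+1}| + |ω_{k+2}|)|ω| |∇v| + |ω|² |∂_kv_k|` (`abs_inner_fderiv_apply_le`);
the first group is the paper's `I₂` (Hölder `γ, 2γ/(γ−1), 2γ/(γ−1)` and the Calderón–Zygmund
bound `‖∇v‖_m ≤ C‖ω‖_m`, tree `exists_eLpNorm_fderiv_le_curl_of_isDivFree_of_eLpNorm_lt_top`),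
the second is `I₁` (`‖∂_kv_k‖_γ ≤ C(‖ω_{k+1}‖_γ + ‖ω_{k+2}‖_γ)`, the row estimate
`exists_eLpNorm_fderiv_apply_le_curl_apply_of_isDivFree_of_eLpNorm_lt_top` — "`P(ω̃)`, the
Calderón–Zygmund inequality"); then the Gagliardo–Nirenberg interpolation
`‖ω‖_{2γ/(γ−1)}² ≤ ‖ω‖₂^{2−3/γ} (K‖∇ω‖₂)^{3/γ}` (Lebesgue interpolation between `2` and `6`,
`lintegral_rpow_interpolate`, and Sobolev `‖ω‖₆ ≤ K‖∇ω‖₂`, `eLpNorm_six_le_eLpNorm_fderiv_two`)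
and Young's inequality (`mul_rpow_mul_rpow_le_absorb`) — (8)–(9) of the paper. The constant is
not the paper's (the `L^s`-tail bookkeeping of the whole-space Calderón–Zygmund bounds is the
tree's), the exponents are.

* `abs_inner_fderiv_apply_le` — the pointwise structure bound;
* `exists_two_mul_integral_stretching_le_of_two_components` — the estimate, for `C^∞`
  divergence-free `v` with `v ∈ L² ∩ L^∞`, `∇v` bounded, `∇v, ∇²v ∈ L²` and
  `ω_{k+1}, ω_{k+2} ∈ L^γ` (all automatic on a slab of the Beale–Kato–Majda class except the last,
  which is the criterion's hypothesis at a.e. time).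

## Mathlib / tree search

Tree: `exists_eLpNorm_fderiv_apply_le_curl_apply_of_isDivFree_of_eLpNorm_lt_top`
(`DivCurlLpRowEstimate`), `exists_eLpNorm_fderiv_le_curl_of_isDivFree_of_eLpNorm_lt_top`
(`DivCurlLpEstimate`), `mul_rpow_mul_rpow_le_absorb` (`SerrinEnstrophyGronwall`),
`lintegral_rpow_interpolate` (`LerayHopfH1Test`), `eLpNorm_six_le_eLpNorm_fderiv_two`
(`SobolevWholeSpace`), `memLp_of_memLp_of_memLp_top` (`OseenHeatLpBounds`),
`lintegral_enorm_sq_eq_eLpNorm_two_sq`, `integrable_sq_norm_of_lintegral_lt_top`,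
`norm_fderiv_apply_basisFun_le`, `sq_opNorm_le_frobeniusNormSq`, `norm_curl_le`.
Mathlib: `ENNReal.lintegral_mul_le_Lp_mul_Lq`, `Real.HolderConjugate`,
`EuclideanSpace.inner_single_left`.

## References

* D. Chae, H.-J. Choe, *Regularity of solutions to the Navier–Stokes equation*, Electron. J.
  Differential Equations 1999 (1999), No. 05, 1–7: Thm. 1 and its proof, (5)–(9), and the
  endpoint case (10)–(11) (open access; text read, pp. 2–5). [ChaeChoe1999]
* A. J. Majda, A. L. Bertozzi, *Vorticity and incompressible flow* (2002), (11.9) and Prop. 10.6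
  (the Calderón–Zygmund input). [MajdaBertozziCUP2002]
-/

noncomputable section

open MeasureTheory Set Filter Topology Function Metric
open scoped ENNReal NNReal ContDiff RealInnerProductSpace

namespace Literature.Analysis.FluidPDE

section Pointwise

/-- A vector of `ℝ³` in the standard basis, grouped around a distinguished index `k`:
`w = w_k e_k + w_{k+1} e_{k+1} + w_{k+2} e_{k+2}` (indices mod `3`). [folklore] -/
private theorem eq_sum_three_basisFun (w : EuclideanSpace ℝ (Fin 3)) (k : Fin 3) :
    w = w k • EuclideanSpace.basisFun (Fin 3) ℝ k +
      (w (k + 1) • EuclideanSpace.basisFun (Fin 3) ℝ (k + 1) +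
        w (k + 2) • EuclideanSpace.basisFun (Fin 3) ℝ (k + 2)) := by
  ext i
  fin_cases k <;> fin_cases i <;> simp [EuclideanSpace.basisFun_apply]

/-- A component is bounded by the vector: `|y k| ≤ ‖y‖`. [folklore] -/
private theorem abs_apply_le_norm_cc (y : EuclideanSpace ℝ (Fin 3)) (k : Fin 3) : |y k| ≤ ‖y‖ := by
  have h := EuclideanSpace.norm_sq_eq y
  have hk : |y k| ^ 2 ≤ ∑ j, |y j| ^ 2 :=
    Finset.single_le_sum (f := fun j => |y j| ^ 2) (fun j _ => sq_nonneg _) (Finset.mem_univ k)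
  have h2 : |y k| ^ 2 ≤ ‖y‖ ^ 2 := by
    rw [h]
    simpa only [Real.norm_eq_abs] using hk
  exact abs_le_of_sq_le_sq' (by nlinarith [norm_nonneg y, abs_nonneg (y k)]) (norm_nonneg _) |>.2

/-- **The structure of the stretching term** (Chae–Choe 1999, (7): the interaction of the third
components alone vanishes). For `w ∈ ℝ³`, a linear map `L` and an index `k`:
`|⟪w, L w⟫| ≤ 2 (|w_{k+1}| + |w_{k+2}|) ‖w‖ ‖L‖ + ‖w‖² |(L e_k)_k|` — writing
`w = w_k e_k + w̃`, `⟪w, Lw⟫ = w_k² (Le_k)_k + w_k ⟪e_k, L w̃⟫ + ⟪w̃, L w⟫` and `‖w̃‖ ≤ |w_{k+1}| + |w_{k+2}|`.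
Applied with `w = ω(x)`, `L = ∇v(x)`: every term of `Σᵢⱼ ωᵢωⱼ∂ⱼvᵢ` other than `ω_k²∂_kv_k`
carries a factor `ω_{k+1}` or `ω_{k+2}`. [cite: ChaeChoe1999, proof of Thm. 1, (7)] -/
theorem abs_inner_apply_self_le (w : EuclideanSpace ℝ (Fin 3))
    (L : EuclideanSpace ℝ (Fin 3) →L[ℝ] EuclideanSpace ℝ (Fin 3)) (k : Fin 3) :
    |⟪w, L w⟫| ≤ 2 * (|w (k + 1)| + |w (k + 2)|) * ‖w‖ * ‖L‖ +
      ‖w‖ ^ 2 * |L (EuclideanSpace.basisFun (Fin 3) ℝ k) k| := by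
  set e := EuclideanSpace.basisFun (Fin 3) ℝ with he
  have he1 : ∀ i, ‖e i‖ = 1 := fun i => by simp [he]
  set t : EuclideanSpace ℝ (Fin 3) := w (k + 1) • e (k + 1) + w (k + 2) • e (k + 2) with ht
  have hw : w = w k • e k + t := eq_sum_three_basisFun w k
  have htn : ‖t‖ ≤ |w (k + 1)| + |w (k + 2)| := by
    calc ‖t‖ ≤ ‖w (k + 1) • e (k + 1)‖ + ‖w (k + 2) • e (k + 2)‖ := norm_add_le _ _
      _ = |w (k + 1)| + |w (k + 2)| := by
          rw [norm_smul, norm_smul, he1, he1, mul_one, mul_one, Real.norm_eq_abs, Real.norm_eq_abs]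
  have hek : ∀ y : EuclideanSpace ℝ (Fin 3), ⟪e k, y⟫ = y k := fun y => by
    simp [he, EuclideanSpace.basisFun_apply, EuclideanSpace.inner_single_left]
  -- the expansion
  have hexp : ⟪w, L w⟫ = w k ^ 2 * L (e k) k + w k * (L t) k + ⟪t, L w⟫ := by
    have hLw : L w = w k • L (e k) + L t := by
      conv_lhs => rw [hw]
      rw [map_add, map_smul]
    calc ⟪w, L w⟫ = ⟪w k • e k + t, L w⟫ := by rw [← hw]
      _ = w k * ⟪e k, L w⟫ + ⟪t, L w⟫ := by rw [inner_add_left, real_inner_smul_left]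
      _ = w k * (w k * L (e k) k + (L t) k) + ⟪t, L w⟫ := by
          rw [hLw, inner_add_right, real_inner_smul_right, hek, hek]
      _ = w k ^ 2 * L (e k) k + w k * (L t) k + ⟪t, L w⟫ := by ring
  have hwk : |w k| ≤ ‖w‖ := abs_apply_le_norm_cc w k
  have h1 : |w k ^ 2 * L (e k) k| ≤ ‖w‖ ^ 2 * |L (e k) k| := by
    rw [abs_mul, abs_pow]
    gcongr
  have h2 : |w k * (L t) k| ≤ ‖w‖ * (‖L‖ * ‖t‖) := by
    rw [abs_mul]
    refine mul_le_mul hwk ((abs_apply_le_norm_cc _ _).trans (L.le_opNorm t)) (abs_nonneg _)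
      (norm_nonneg _)
  have h3 : |⟪t, L w⟫| ≤ ‖t‖ * (‖L‖ * ‖w‖) :=
    (abs_real_inner_le_norm _ _).trans (mul_le_mul_of_nonneg_left (L.le_opNorm w) (norm_nonneg _))
  have hL0 : 0 ≤ ‖L‖ := norm_nonneg _
  have hw0 : 0 ≤ ‖w‖ := norm_nonneg _
  rw [hexp]
  calc |w k ^ 2 * L (e k) k + w k * (L t) k + ⟪t, L w⟫|
      ≤ |w k ^ 2 * L (e k) k| + |w k * (L t) k| + |⟪t, L w⟫| := abs_add_three _ _ _
    _ ≤ ‖w‖ ^ 2 * |L (e k) k| + ‖w‖ * (‖L‖ * ‖t‖) + ‖t‖ * (‖L‖ * ‖w‖) :=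
        add_le_add (add_le_add h1 h2) h3
    _ = 2 * ‖t‖ * ‖w‖ * ‖L‖ + ‖w‖ ^ 2 * |L (e k) k| := by ring
    _ ≤ 2 * (|w (k + 1)| + |w (k + 2)|) * ‖w‖ * ‖L‖ + ‖w‖ ^ 2 * |L (e k) k| := by
        gcongr

end Pointwise


section Estimate

-- nested operator types (second derivatives)
set_option maxSynthPendingDepth 3

/-- Exponent algebra (as in the tree's Beirão da Veiga slice bound): for `ρ > 3/2` and
`m = 2ρ/(ρ-1)`, `2 < m < 6`, `(ρ, m/2)` are Hölder conjugate, and the interpolation exponents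
between `L²` and `L⁶` at `L^m`, multiplied by `2/m`, are `1 - 3/(2ρ)` and `1/(2ρ)`. [folklore] -/
private theorem cc_exponent_algebra {ρ : ℝ} (hρ : 3 / 2 < ρ) :
    let m : ℝ := 2 * ρ / (ρ - 1)
    2 < m ∧ m < 6 ∧ ρ.HolderConjugate (m / 2) ∧
      (6 - m) / (6 - 2) * (2 / m) = 1 - 3 / (2 * ρ) ∧ (m - 2) / (6 - 2) * (2 / m) = 1 / (2 * ρ) := by
  intro m
  have hρ1 : 0 < ρ - 1 := by linarith
  have hρ0 : 0 < ρ := by linarith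
  have hm : m = 2 * ρ / (ρ - 1) := rfl
  refine ⟨?_, ?_, ?_, ?_, ?_⟩
  · rw [hm, lt_div_iff₀ hρ1]; linarith
  · rw [hm, div_lt_iff₀ hρ1]; linarith
  · rw [Real.holderConjugate_iff]
    refine ⟨by linarith, ?_⟩
    rw [hm]; field_simp; ring
  · rw [hm]; field_simp; ring
  · rw [hm]; field_simp; ring

/-- `(3/2 : ℝ≥0∞) < γ < ∞` in real terms. [folklore] -/
private theorem toReal_three_halves_lt {γ : ℝ≥0∞} (hγ : 3 / 2 < γ) (hγtop : γ ≠ ⊤) :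
    3 / 2 < γ.toReal := by
  have h : ((3 / 2 : ℝ≥0∞)).toReal < γ.toReal :=
    (ENNReal.toReal_lt_toReal (ENNReal.div_ne_top (by norm_num) (by norm_num)) hγtop).2 hγ
  have h32 : ((3 / 2 : ℝ≥0∞)).toReal = 3 / 2 := by
    rw [ENNReal.toReal_div, ENNReal.toReal_ofNat, ENNReal.toReal_ofNat]
  rw [h32] at h
  exact h

/-- **The diagonal entry `∂_kv_k` is controlled in `L^γ` by the two other vorticity components**
for smooth divergence-free fields in `L² ∩ L^∞` (`3/2 < γ < ∞`): the row estimate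
`exists_eLpNorm_fderiv_apply_le_curl_apply_of_isDivFree_of_eLpNorm_lt_top` with the `L²` tail
when `γ ≤ 2` and with the `L^γ` tail (from `L² ∩ L^∞ ⊂ L^γ`) when `γ > 2` (Chae–Choe:
`P(ω̃)`). [cite: ChaeChoe1999, proof of Thm. 1, (7)–(8)] -/
theorem exists_eLpNorm_fderiv_apply_apply_le_of_two_components {γ : ℝ≥0∞} (hγ : 3 / 2 < γ)
    (hγtop : γ ≠ ⊤) (k : Fin 3) :
    ∃ C₂ : ℝ≥0, ∀ v : EuclideanSpace ℝ (Fin 3) → EuclideanSpace ℝ (Fin 3), ContDiff ℝ ∞ v →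
      VectorCalculus.IsDivFree v → eLpNorm v 2 volume < ⊤ → eLpNorm v ⊤ volume < ⊤ →
        eLpNorm (fun x => fderiv ℝ v x (EuclideanSpace.basisFun (Fin 3) ℝ k) k) γ volume ≤
          C₂ * (eLpNorm (fun x => curl v x (k + 1)) γ volume +
            eLpNorm (fun x => curl v x (k + 2)) γ volume) := by
  have h32 : (1 : ℝ≥0∞) < 3 / 2 := by
    rw [ENNReal.lt_div_iff_mul_lt (Or.inl (by norm_num)) (Or.inl (by norm_num))]
    norm_num
  have h1γ : 1 < γ := lt_trans h32 hγ
  have hρ := toReal_three_halves_lt hγ hγtop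
  have he1 : ‖(EuclideanSpace.basisFun (Fin 3) ℝ k : EuclideanSpace ℝ (Fin 3))‖ ≤ 1 := by simp
  by_cases hγ2 : γ ≤ 2
  · have hgap : 3 * (1 / γ.toReal - 1 / (2 : ℝ≥0∞).toReal) < 1 := by
      rw [ENNReal.toReal_ofNat]
      have : 1 / γ.toReal < 2 / 3 := by
        rw [div_lt_div_iff₀ (by linarith) (by norm_num)]; linarith
      linarith
    obtain ⟨C, hC⟩ := exists_eLpNorm_fderiv_apply_le_curl_apply_of_isDivFree_of_eLpNorm_lt_top
      (p := γ) (s := 2) h1γ hγ2 (by norm_num) hgap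
    exact ⟨C, fun v hv hdiv h2 _ => hC v hv hdiv h2 _ he1 k⟩
  · rw [not_le] at hγ2
    obtain ⟨C, hC⟩ := exists_eLpNorm_fderiv_apply_le_curl_apply_of_isDivFree_of_eLpNorm_lt_top
      (p := γ) (s := γ) h1γ le_rfl hγtop.lt_top (by rw [sub_self, mul_zero]; exact zero_lt_one)
    refine ⟨C, fun v hv hdiv h2 htop => hC v hv hdiv ?_ _ he1 k⟩
    have hm : AEStronglyMeasurable v volume := hv.continuous.aestronglyMeasurable
    exact (memLp_of_memLp_of_memLp_top (by norm_num) hγ2.le ⟨hm, h2⟩ ⟨hm, htop⟩).eLpNorm_lt_top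

set_option maxHeartbeats 1600000 in
/-- **Chae–Choe's stretching estimate** (Chae–Choe 1999, proof of Thm. 1, (5)–(9): with
`ω̃ = ω₁e₁ + ω₂e₂`, `|∫(ω·∇)v·ω| ≤ C∫|ω|²|P(ω̃)| + C∫|ω||P(ω')||ω̃| = I₁ + I₂`,
`I₁, I₂ ≤ C‖ω̃‖_γ^{2γ/(2γ−3)}‖ω‖²₂ + (ν/4)‖∇ω‖²₂` by Hölder, Calderón–Zygmund, Gagliardo–Nirenberg and
Young). For `3/2 < γ < ∞`, `ν > 0` and a free index `k` there is `C = C(γ, ν) ≥ 0` such that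
every `C^∞` divergence-free field `v` on `ℝ³` with `v ∈ L² ∩ L^∞`, `∇v` bounded, `∇v, ∇²v ∈ L²`
and `ω_{k+1}, ω_{k+2} ∈ L^γ` (`ω = curl v`, indices mod `3`) satisfies
`2∫⟪ω, (∇v)ω⟫ ≤ ν ∫|∇ω|²_F + C (‖ω_{k+1}‖_{L^γ}^{q} + ‖ω_{k+2}‖_{L^γ}^{q}) ∫|ω|²`,
`q = 1/(1 − 3/(2γ)) = 2γ/(2γ−3)`. Pointwise structure `abs_inner_apply_self_le`, Hölder
(`γ`, `m/2`), `m = 2γ/(γ−1)`, and Cauchy–Schwarz, the tree's Calderón–Zygmund bounds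
`‖∇v‖_m ≤ C₁‖ω‖_m` and `‖∂_kv_k‖_γ ≤ C₂(‖ω_{k+1}‖_γ + ‖ω_{k+2}‖_γ)`, Lebesgue interpolation
`2`–`6`, Sobolev `‖ω‖₆ ≤ K‖∇ω‖₂`, Young with exponents `1/θ`, `1/(1−θ)`, `θ = 1 − 3/(2γ)`, and
`(a+b)^q ≤ 2^{q−1}(a^q + b^q)`. The constant is not the printed one. [cite: ChaeChoe1999, Thm. 1 and proof, (5)–(9) (pp. 2–4); MajdaBertozziCUP2002, Ch. 11 (11.9) with Prop. 10.6] -/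
theorem exists_two_mul_integral_stretching_le_of_two_components {γ : ℝ≥0∞} (hγ : 3 / 2 < γ)
    (hγtop : γ ≠ ⊤) {ν : ℝ} (hν : 0 < ν) (k : Fin 3) :
    ∃ C : ℝ, 0 ≤ C ∧ ∀ v : EuclideanSpace ℝ (Fin 3) → EuclideanSpace ℝ (Fin 3), ContDiff ℝ ∞ v →
      VectorCalculus.IsDivFree v → eLpNorm v 2 volume < ⊤ → eLpNorm v ⊤ volume < ⊤ →
      ∀ {B₁ : ℝ}, (∀ x, ‖fderiv ℝ v x‖ ≤ B₁) →
      (∫⁻ x, ‖iteratedFDeriv ℝ 1 v x‖ₑ ^ 2 < ⊤) → (∫⁻ x, ‖iteratedFDeriv ℝ 2 v x‖ₑ ^ 2 < ⊤) →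
      eLpNorm (fun x => curl v x (k + 1)) γ volume < ⊤ →
      eLpNorm (fun x => curl v x (k + 2)) γ volume < ⊤ →
        2 * ∫ x, ⟪curl v x, fderiv ℝ v x (curl v x)⟫ ≤
          ν * (∫ x, frobeniusNormSq (fderiv ℝ (curl v) x)) +
            C * ((eLpNorm (fun x => curl v x (k + 1)) γ volume).toReal ^ (1 / (1 - 3 / (2 * γ.toReal))) +
                (eLpNorm (fun x => curl v x (k + 2)) γ volume).toReal ^ (1 / (1 - 3 / (2 * γ.toReal)))) *
              ∫ x, ‖curl v x‖ ^ 2 := by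
  set e := EuclideanSpace.basisFun (Fin 3) ℝ with he
  have he1 : ∀ i, ‖e i‖ = 1 := fun i => by simp [he]
  set K : ℝ≥0 := SNormLESNormFDerivOfEqConst (EuclideanSpace ℝ (Fin 3))
    (volume : Measure (EuclideanSpace ℝ (Fin 3))) 2 with hK
  -- the real exponents
  have hγ0 : γ ≠ 0 := (lt_trans (by norm_num) hγ).ne'
  set ρ : ℝ := γ.toReal with hρ
  have hρ3 : 3 / 2 < ρ := toReal_three_halves_lt hγ hγtop
  have hρ0 : 0 < ρ := by linarith
  obtain ⟨h2m, hm6, hconj, hexpθ, hexp1⟩ := cc_exponent_algebra hρ3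
  set m : ℝ := 2 * ρ / (ρ - 1) with hm
  have hm0 : 0 < m := by linarith
  set θ : ℝ := 1 - 3 / (2 * ρ) with hθ
  have hθ0 : 0 < θ := by
    rw [hθ, sub_pos, div_lt_one (by positivity)]; linarith
  have hθ1 : θ < 1 := by
    rw [hθ]; linarith [div_pos (zero_lt_three' ℝ) (by positivity : (0 : ℝ) < 2 * ρ)]
  have h1θ : 0 ≤ 1 - θ := by linarith
  -- the exponent `m` as an `ℝ≥0∞`
  set mE : ℝ≥0∞ := ENNReal.ofReal m with hmE
  have hmEr : mE.toReal = m := ENNReal.toReal_ofReal hm0.le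
  have h1mE : 1 < mE := by
    rw [hmE, ← ENNReal.ofReal_one]; exact (ENNReal.ofReal_lt_ofReal_iff hm0).2 (by linarith)
  have hmE6 : mE ≤ 6 := by
    rw [hmE, show (6 : ℝ≥0∞) = ENNReal.ofReal 6 by norm_num]; exact ENNReal.ofReal_le_ofReal hm6.le
  have hgap : 3 * (1 / mE.toReal - 1 / (6 : ℝ≥0∞).toReal) < 1 := by
    rw [hmEr, ENNReal.toReal_ofNat]
    have : 1 / m < 1 / 2 := by
      rw [div_lt_div_iff₀ hm0 (by norm_num)]; linarith
    linarith
  -- the constants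
  obtain ⟨C₁, hC₁⟩ := exists_eLpNorm_fderiv_le_curl_of_isDivFree_of_eLpNorm_lt_top
    (p := mE) (s := 6) h1mE hmE6 (by norm_num) hgap
  obtain ⟨C₂, hC₂⟩ := exists_eLpNorm_fderiv_apply_apply_le_of_two_components hγ hγtop k
  set Aw : ℝ≥0 := 2 * C₁ + C₂ with hAw
  set c₀ : ℝ := θ * (2 * (1 - θ)) ^ ((1 - θ) / θ) * ν ^ (-((1 - θ) / θ)) with hc₀
  have hc₀0 : 0 ≤ c₀ := by
    rw [hc₀]
    have : 0 ≤ ν ^ (-((1 - θ) / θ)) := Real.rpow_nonneg hν.le _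
    positivity
  set C : ℝ := 2 * c₀ * ((Aw : ℝ) * (K : ℝ) ^ (2 * (1 - θ))) ^ (1 / θ) * (2 : ℝ) ^ (1 / θ - 1)
    with hCdef
  have hC0 : 0 ≤ C := by rw [hCdef]; positivity
  refine ⟨C, hC0, ?_⟩
  intro v hv hdiv hv2 hvtop B₁ hB₁ hv1 hv2' hN1 hN2
  -- the vorticity and its regularity
  have hv3 : ContDiff ℝ 3 v := hv.of_le (by norm_cast)
  have hvm : AEStronglyMeasurable v volume := hv.continuous.aestronglyMeasurable
  set om : EuclideanSpace ℝ (Fin 3) → EuclideanSpace ℝ (Fin 3) := curl v with homdef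
  have hom : ContDiff ℝ ∞ om := contDiff_curl (n := ⊤) (hv.of_le (by exact_mod_cast le_top))
  have hom1 : ContDiff ℝ 1 om := hom.of_le (by norm_cast)
  have cω : Continuous om := hom.continuous
  have cDv : Continuous (fderiv ℝ v) := hv.continuous_fderiv (by simp)
  have cDω : Continuous (fderiv ℝ om) := hom.continuous_fderiv (by simp)
  have cωj : ∀ j, Continuous fun x => om x j := fun j => (EuclideanSpace.proj j).continuous.comp cω
  have cakk : Continuous fun x => fderiv ℝ v x (e k) k :=
    (EuclideanSpace.proj k).continuous.comp (cDv.clm_apply continuous_const)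
  have hB₁0 : 0 ≤ B₁ := (norm_nonneg _).trans (hB₁ 0)
  -- `ω, ∇ω ∈ L²`
  set κ : ℝ := ‖curlCLM‖ with hκ
  have l2ω : ∫⁻ x, ‖om x‖ₑ ^ 2 < ⊤ :=
    lt_of_le_of_lt (lintegral_curl_sq_le v) (ENNReal.mul_lt_top ENNReal.ofReal_lt_top hv1)
  have l2Dω : ∫⁻ x, ‖fderiv ℝ om x‖ₑ ^ 2 < ⊤ := by
    have hle : ∀ x, ‖fderiv ℝ om x‖ ≤ ‖κ • iteratedFDeriv ℝ 2 v x‖ := fun x => by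
      rw [norm_smul, Real.norm_of_nonneg (norm_nonneg curlCLM)]
      have h1 : ‖fderiv ℝ om x‖ = ‖iteratedFDeriv ℝ 1 om x‖ := by
        rw [← norm_iteratedFDeriv_fderiv, norm_iteratedFDeriv_zero]
      rw [h1, homdef]
      exact norm_iteratedFDeriv_curl_le_opNorm_mul hv3 1 (by norm_num) x
    refine lintegral_enorm_sq_lt_top_of_norm_le hle ?_
    have h2 : ∫⁻ x, ‖κ • iteratedFDeriv ℝ 2 v x‖ₑ ^ 2 = ‖κ‖ₑ ^ 2 * ∫⁻ x, ‖iteratedFDeriv ℝ 2 v x‖ₑ ^ 2 := by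
      rw [← lintegral_const_mul' _ _ (by simp)]
      exact lintegral_congr fun x => by rw [enorm_smul, mul_pow]
    rw [h2]
    exact ENNReal.mul_lt_top (by simp) hv2'
  -- the real quantities `a = ∫|ω|²`, `R = ∫|∇ω|²_F`
  have i_a : Integrable (fun x => ‖om x‖ ^ 2) volume := integrable_sq_norm_of_lintegral_lt_top cω l2ω
  set a : ℝ := ∫ x, ‖om x‖ ^ 2 with ha
  have ha0 : 0 ≤ a := integral_nonneg fun x => sq_nonneg _
  have hRlt : ∫⁻ x, ENNReal.ofReal (frobeniusNormSq (fderiv ℝ om x)) < ⊤ := by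
    calc ∫⁻ x, ENNReal.ofReal (frobeniusNormSq (fderiv ℝ om x))
        ≤ ∫⁻ x, 3 * ‖fderiv ℝ om x‖ₑ ^ 2 :=
          lintegral_mono fun x => ofReal_frobeniusNormSq_le_three_mul_enorm_sq _
      _ = 3 * ∫⁻ x, ‖fderiv ℝ om x‖ₑ ^ 2 := lintegral_const_mul' _ _ (by norm_num)
      _ < ⊤ := ENNReal.mul_lt_top (by norm_num) l2Dω
  have i_R : Integrable (fun x => frobeniusNormSq (fderiv ℝ om x)) volume :=
    integrable_of_continuous_of_nonneg (continuous_frobeniusNormSq_fderiv hom1 (by simp))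
      (fun x => frobeniusNormSq_nonneg _) hRlt
  set R : ℝ := ∫ x, frobeniusNormSq (fderiv ℝ om x) with hR
  have hR0 : 0 ≤ R := integral_nonneg fun x => frobeniusNormSq_nonneg _
  have hRE : ENNReal.ofReal R = ∫⁻ x, ENNReal.ofReal (frobeniusNormSq (fderiv ℝ om x)) :=
    ofReal_integral_eq_lintegral_ofReal i_R (Eventually.of_forall fun x => frobeniusNormSq_nonneg _)
  have hD : eLpNorm (fderiv ℝ om) 2 volume ^ 2 ≤ ENNReal.ofReal R := by
    rw [← lintegral_enorm_sq_eq_eLpNorm_two_sq, hRE]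
    refine lintegral_mono fun x => ?_
    rw [← ofReal_norm, ← ENNReal.ofReal_pow (norm_nonneg _)]
    exact ENNReal.ofReal_le_ofReal (sq_opNorm_le_frobeniusNormSq _)
  -- the two controlled vorticity components
  set N₁ : ℝ≥0 := (eLpNorm (fun x => om x (k + 1)) γ volume).toNNReal with hN₁
  set N₂ : ℝ≥0 := (eLpNorm (fun x => om x (k + 2)) γ volume).toNNReal with hN₂
  have hN₁E : ((N₁ : ℝ≥0) : ℝ≥0∞) = eLpNorm (fun x => om x (k + 1)) γ volume :=
    ENNReal.coe_toNNReal hN1.ne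
  have hN₂E : ((N₂ : ℝ≥0) : ℝ≥0∞) = eLpNorm (fun x => om x (k + 2)) γ volume :=
    ENNReal.coe_toNNReal hN2.ne
  have hN₁R : (eLpNorm (fun x => om x (k + 1)) γ volume).toReal = (N₁ : ℝ) := rfl
  have hN₂R : (eLpNorm (fun x => om x (k + 2)) γ volume).toReal = (N₂ : ℝ) := rfl
  -- the pointwise structure bound and the majorant `g`
  set g : EuclideanSpace ℝ (Fin 3) → ℝ := fun x =>
    2 * (|om x (k + 1)| + |om x (k + 2)|) * ‖om x‖ * ‖fderiv ℝ v x‖ +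
      ‖om x‖ ^ 2 * |fderiv ℝ v x (e k) k| with hg
  have hg0 : ∀ x, 0 ≤ g x := fun x => by positivity
  have hSg : ∀ x, ⟪om x, fderiv ℝ v x (om x)⟫ ≤ g x := fun x =>
    (le_abs_self _).trans (abs_inner_apply_self_le (om x) (fderiv ℝ v x) k)
  have hgm : AEStronglyMeasurable g volume :=
    ((((continuous_const.mul (((cωj _).abs).add ((cωj _).abs))).mul cω.norm).mul cDv.norm).add
      ((cω.norm.pow 2).mul cakk.abs)).aestronglyMeasurable
  have i_g : Integrable g volume := by
    have hdom : Integrable (fun x => 5 * B₁ * ‖om x‖ ^ 2) volume := i_a.const_mul _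
    refine hdom.mono' hgm (Eventually.of_forall fun x => ?_)
    rw [Real.norm_of_nonneg (hg0 x), hg]
    dsimp only
    have h1 : |om x (k + 1)| ≤ ‖om x‖ := abs_apply_le_norm_cc _ _
    have h2 : |om x (k + 2)| ≤ ‖om x‖ := abs_apply_le_norm_cc _ _
    have h3 : |fderiv ℝ v x (e k) k| ≤ B₁ := by
      refine (abs_apply_le_norm_cc _ _).trans (((fderiv ℝ v x).le_opNorm _).trans ?_)
      rw [he1, mul_one]; exact hB₁ x
    have h4 : ‖fderiv ℝ v x‖ ≤ B₁ := hB₁ x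
    have hw0 : 0 ≤ ‖om x‖ := norm_nonneg _
    calc 2 * (|om x (k + 1)| + |om x (k + 2)|) * ‖om x‖ * ‖fderiv ℝ v x‖ +
          ‖om x‖ ^ 2 * |fderiv ℝ v x (e k) k|
        ≤ 2 * (‖om x‖ + ‖om x‖) * ‖om x‖ * B₁ + ‖om x‖ ^ 2 * B₁ := by gcongr
      _ = 5 * B₁ * ‖om x‖ ^ 2 := by ring
  have hSle : ∫ x, ⟪om x, fderiv ℝ v x (om x)⟫ ≤ ∫ x, g x := by
    by_cases hS : Integrable (fun x => ⟪om x, fderiv ℝ v x (om x)⟫) volume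
    · exact integral_mono hS i_g hSg
    · rw [integral_undef hS]; exact integral_nonneg hg0
  -- `ℝ≥0∞` form of `∫ g`
  set Wm : ℝ≥0∞ := (∫⁻ x, ‖om x‖ₑ ^ m) ^ (1 / m) with hWm
  set Wm2 : ℝ≥0∞ := (∫⁻ x, ‖om x‖ₑ ^ m) ^ (2 / m) with hWm2
  set Dm : ℝ≥0∞ := (∫⁻ x, ‖fderiv ℝ v x‖ₑ ^ m) ^ (1 / m) with hDm
  have hWmsq : Wm * Wm = Wm2 := by
    rw [hWm, hWm2, ← sq, ← ENNReal.rpow_two, ← ENNReal.rpow_mul]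
    congr 1; field_simp
  have hpt : ∀ x, ENNReal.ofReal (g x) =
      2 * (‖om x (k + 1)‖ₑ + ‖om x (k + 2)‖ₑ) * ‖om x‖ₑ * ‖fderiv ℝ v x‖ₑ +
        ‖om x‖ₑ ^ (2 : ℝ) * ‖fderiv ℝ v x (e k) k‖ₑ := by
    intro x
    rw [hg]
    dsimp only
    have hs0 : 0 ≤ |om x (k + 1)| + |om x (k + 2)| := by positivity
    rw [ENNReal.ofReal_add (by positivity) (by positivity),
      ENNReal.ofReal_mul (by positivity : 0 ≤ 2 * (|om x (k + 1)| + |om x (k + 2)|) * ‖om x‖),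
      ENNReal.ofReal_mul (by positivity : 0 ≤ 2 * (|om x (k + 1)| + |om x (k + 2)|)),
      ENNReal.ofReal_mul (by norm_num : (0 : ℝ) ≤ 2), ENNReal.ofReal_add (abs_nonneg _) (abs_nonneg _),
      ENNReal.ofReal_mul (sq_nonneg _), ENNReal.ofReal_pow (norm_nonneg _), ENNReal.ofReal_ofNat]
    simp only [ofReal_norm, ← Real.enorm_eq_ofReal_abs, ENNReal.rpow_two]
  have mω : AEMeasurable (fun x => ‖om x‖ₑ) volume := cω.aemeasurable.enorm
  have mDv : AEMeasurable (fun x => ‖fderiv ℝ v x‖ₑ) volume := cDv.aemeasurable.enorm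
  have mωj : ∀ j, AEMeasurable (fun x => ‖om x j‖ₑ) volume := fun j => (cωj j).aemeasurable.enorm
  have makk : AEMeasurable (fun x => ‖fderiv ℝ v x (e k) k‖ₑ) volume := cakk.aemeasurable.enorm
  -- Hölder for the off-diagonal group: `∫ |ω_j| |ω| |Dv| ≤ ‖ω_j‖_γ ‖ω‖_m ‖Dv‖_m`
  have h22 : (2 : ℝ).HolderConjugate 2 := by rw [Real.holderConjugate_iff]; norm_num
  have hCS : (∫⁻ x, (‖om x‖ₑ * ‖fderiv ℝ v x‖ₑ) ^ (m / 2)) ^ (2 / m) ≤ Wm * Dm := by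
    have hmul : ∀ x, (‖om x‖ₑ * ‖fderiv ℝ v x‖ₑ) ^ (m / 2) =
        ‖om x‖ₑ ^ (m / 2) * ‖fderiv ℝ v x‖ₑ ^ (m / 2) := fun x =>
      ENNReal.mul_rpow_of_nonneg _ _ (by positivity)
    have hpow : ∀ y : ℝ≥0∞, (y ^ (m / 2)) ^ (2 : ℝ) = y ^ m := fun y => by
      rw [← ENNReal.rpow_mul]; congr 1; ring
    have hcs := ENNReal.lintegral_mul_le_Lp_mul_Lq volume h22
      (f := fun x => ‖om x‖ₑ ^ (m / 2)) (g := fun x => ‖fderiv ℝ v x‖ₑ ^ (m / 2))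
      (mω.pow_const _) (mDv.pow_const _)
    simp only [Pi.mul_apply, hpow] at hcs
    calc (∫⁻ x, (‖om x‖ₑ * ‖fderiv ℝ v x‖ₑ) ^ (m / 2)) ^ (2 / m)
        = (∫⁻ x, ‖om x‖ₑ ^ (m / 2) * ‖fderiv ℝ v x‖ₑ ^ (m / 2)) ^ (2 / m) := by
          rw [lintegral_congr fun x => hmul x]
      _ ≤ ((∫⁻ x, ‖om x‖ₑ ^ m) ^ (1 / (2 : ℝ)) * (∫⁻ x, ‖fderiv ℝ v x‖ₑ ^ m) ^ (1 / (2 : ℝ))) ^ (2 / m) := by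
          gcongr
      _ = Wm * Dm := by
          rw [ENNReal.mul_rpow_of_nonneg _ _ (by positivity), ← ENNReal.rpow_mul, ← ENNReal.rpow_mul,
            hWm, hDm]
          congr 2 <;> field_simp
  have hT1 : ∀ j, ∫⁻ x, ‖om x j‖ₑ * (‖om x‖ₑ * ‖fderiv ℝ v x‖ₑ) ≤
      eLpNorm (fun x => om x j) γ volume * (Wm * Dm) := by
    intro j
    have h := ENNReal.lintegral_mul_le_Lp_mul_Lq volume hconj (f := fun x => ‖om x j‖ₑ)
      (g := fun x => ‖om x‖ₑ * ‖fderiv ℝ v x‖ₑ) (mωj j) (mω.mul mDv)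
    simp only [Pi.mul_apply] at h
    have hf : (∫⁻ x, ‖om x j‖ₑ ^ ρ) ^ (1 / ρ) = eLpNorm (fun x => om x j) γ volume := by
      rw [eLpNorm_eq_lintegral_rpow_enorm_toReal hγ0 hγtop, ← hρ]
    have e2 : 1 / (m / 2) = 2 / m := by field_simp
    rw [hf, e2] at h
    exact h.trans (mul_le_mul' le_rfl hCS)
  -- Hölder for the diagonal term: `∫ |∂_kv_k| |ω|² ≤ ‖∂_kv_k‖_γ ‖ω‖_m²`
  have hT2 : ∫⁻ x, ‖om x‖ₑ ^ (2 : ℝ) * ‖fderiv ℝ v x (e k) k‖ₑ ≤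
      eLpNorm (fun x => fderiv ℝ v x (e k) k) γ volume * Wm2 := by
    have h := ENNReal.lintegral_mul_le_Lp_mul_Lq volume hconj
      (f := fun x => ‖fderiv ℝ v x (e k) k‖ₑ) (g := fun x => ‖om x‖ₑ ^ (2 : ℝ))
      makk (mω.pow_const _)
    have hgm' : ∀ x, (‖om x‖ₑ ^ (2 : ℝ)) ^ (m / 2) = ‖om x‖ₑ ^ m := fun x => by
      rw [← ENNReal.rpow_mul]; congr 1; field_simp
    simp only [Pi.mul_apply, hgm'] at h
    have hf : (∫⁻ x, ‖fderiv ℝ v x (e k) k‖ₑ ^ ρ) ^ (1 / ρ) =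
        eLpNorm (fun x => fderiv ℝ v x (e k) k) γ volume := by
      rw [eLpNorm_eq_lintegral_rpow_enorm_toReal hγ0 hγtop, ← hρ]
    have e2 : 1 / (m / 2) = 2 / m := by field_simp
    rw [hf, e2] at h
    calc ∫⁻ x, ‖om x‖ₑ ^ (2 : ℝ) * ‖fderiv ℝ v x (e k) k‖ₑ
        = ∫⁻ x, ‖fderiv ℝ v x (e k) k‖ₑ * ‖om x‖ₑ ^ (2 : ℝ) := lintegral_congr fun x => mul_comm _ _
      _ ≤ _ := h
  -- the Calderón–Zygmund inputs
  have hv6 : eLpNorm v 6 volume < ⊤ :=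
    (memLp_of_memLp_of_memLp_top (p := 2) (q := 6) (by norm_num) (by norm_num) ⟨hvm, hv2⟩
      ⟨hvm, hvtop⟩).eLpNorm_lt_top
  have hmE0 : mE ≠ 0 := (lt_trans zero_lt_one h1mE).ne'
  have hmEtop : mE ≠ ⊤ := ENNReal.ofReal_ne_top
  have hDm_le : Dm ≤ C₁ * Wm := by
    have h := hC₁ v hv hdiv hv6
    rw [eLpNorm_eq_lintegral_rpow_enorm_toReal hmE0 hmEtop,
      eLpNorm_eq_lintegral_rpow_enorm_toReal hmE0 hmEtop, hmEr, ← homdef] at h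
    exact h
  have hrow : eLpNorm (fun x => fderiv ℝ v x (e k) k) γ volume ≤ C₂ * ((N₁ : ℝ≥0∞) + N₂) := by
    have h := hC₂ v hv hdiv hv2 hvtop
    rw [← homdef] at h
    rw [hN₁E, hN₂E]
    exact h
  -- the bound for `∫ g` in `ℝ≥0∞`
  have hsum : ENNReal.ofReal (∫ x, g x) ≤ (Aw : ℝ≥0∞) * ((N₁ : ℝ≥0∞) + N₂) * Wm2 := by
    rw [ofReal_integral_eq_lintegral_ofReal i_g (Eventually.of_forall hg0)]
    have hsplit : ∀ x, ENNReal.ofReal (g x) =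
        2 * (‖om x (k + 1)‖ₑ * (‖om x‖ₑ * ‖fderiv ℝ v x‖ₑ)) +
          2 * (‖om x (k + 2)‖ₑ * (‖om x‖ₑ * ‖fderiv ℝ v x‖ₑ)) +
          ‖om x‖ₑ ^ (2 : ℝ) * ‖fderiv ℝ v x (e k) k‖ₑ := fun x => by
      rw [hpt x]; ring
    have m1 : AEMeasurable (fun x => 2 * (‖om x (k + 1)‖ₑ * (‖om x‖ₑ * ‖fderiv ℝ v x‖ₑ))) volume :=
      ((mωj _).mul (mω.mul mDv)).const_mul _
    have m2 : AEMeasurable (fun x => 2 * (‖om x (k + 2)‖ₑ * (‖om x‖ₑ * ‖fderiv ℝ v x‖ₑ))) volume :=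
      ((mωj _).mul (mω.mul mDv)).const_mul _
    calc ∫⁻ x, ENNReal.ofReal (g x)
        = ∫⁻ x, (2 * (‖om x (k + 1)‖ₑ * (‖om x‖ₑ * ‖fderiv ℝ v x‖ₑ)) +
            2 * (‖om x (k + 2)‖ₑ * (‖om x‖ₑ * ‖fderiv ℝ v x‖ₑ)) +
            ‖om x‖ₑ ^ (2 : ℝ) * ‖fderiv ℝ v x (e k) k‖ₑ) := lintegral_congr hsplit
      _ = 2 * (∫⁻ x, ‖om x (k + 1)‖ₑ * (‖om x‖ₑ * ‖fderiv ℝ v x‖ₑ)) +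
            2 * (∫⁻ x, ‖om x (k + 2)‖ₑ * (‖om x‖ₑ * ‖fderiv ℝ v x‖ₑ)) +
            ∫⁻ x, ‖om x‖ₑ ^ (2 : ℝ) * ‖fderiv ℝ v x (e k) k‖ₑ := by
          have m12 : AEMeasurable (fun x => 2 * (‖om x (k + 1)‖ₑ * (‖om x‖ₑ * ‖fderiv ℝ v x‖ₑ)) +
              2 * (‖om x (k + 2)‖ₑ * (‖om x‖ₑ * ‖fderiv ℝ v x‖ₑ))) volume := m1.add m2
          rw [lintegral_add_left' m12, lintegral_add_left' m1,
            lintegral_const_mul' 2 _ (by norm_num), lintegral_const_mul' 2 _ (by norm_num)]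
      _ ≤ 2 * ((N₁ : ℝ≥0∞) * (Wm * Dm)) + 2 * ((N₂ : ℝ≥0∞) * (Wm * Dm)) +
            C₂ * ((N₁ : ℝ≥0∞) + N₂) * Wm2 := by
          have h1' := hT1 (k + 1)
          have h2' := hT1 (k + 2)
          rw [← hN₁E] at h1'
          rw [← hN₂E] at h2'
          exact add_le_add (add_le_add (mul_le_mul' le_rfl h1') (mul_le_mul' le_rfl h2'))
            (hT2.trans (mul_le_mul' hrow le_rfl))
      _ ≤ 2 * ((N₁ : ℝ≥0∞) * (Wm * (C₁ * Wm))) + 2 * ((N₂ : ℝ≥0∞) * (Wm * (C₁ * Wm))) +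
            C₂ * ((N₁ : ℝ≥0∞) + N₂) * Wm2 :=
          add_le_add (add_le_add
            (mul_le_mul' le_rfl (mul_le_mul' le_rfl (mul_le_mul' le_rfl hDm_le)))
            (mul_le_mul' le_rfl (mul_le_mul' le_rfl (mul_le_mul' le_rfl hDm_le)))) le_rfl
      _ = (Aw : ℝ≥0∞) * ((N₁ : ℝ≥0∞) + N₂) * Wm2 := by
          rw [hAw, ← hWmsq]; push_cast; ring
  -- interpolation `2`–`6` and Sobolev: `‖ω‖_m² ≤ a^θ (K² R)^{1-θ}`
  have hA : ENNReal.ofReal a = ∫⁻ x, ‖om x‖ₑ ^ (2 : ℝ) := by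
    rw [ha, ofReal_integral_eq_lintegral_ofReal i_a (Eventually.of_forall fun x => sq_nonneg _)]
    refine lintegral_congr fun x => ?_
    rw [← ofReal_norm, ENNReal.ofReal_rpow_of_nonneg (norm_nonneg _) (by norm_num), Real.rpow_two]
  have hS : eLpNorm om 6 volume ≤ K * eLpNorm (fderiv ℝ om) 2 volume :=
    eLpNorm_six_le_eLpNorm_fderiv_two volume finrank_euclideanSpace_fin hom1
      (eLpNorm_two_lt_top_of_lintegral_enorm_sq_lt_top l2ω)
  have hS6 : ∫⁻ x, ‖om x‖ₑ ^ (6 : ℝ) ≤ ((K : ℝ≥0∞) ^ 2 * ENNReal.ofReal R) ^ (3 : ℝ) := by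
    have h6 : ∫⁻ x, ‖om x‖ₑ ^ (6 : ℝ) = eLpNorm om 6 volume ^ (6 : ℝ) := by
      rw [eLpNorm_eq_lintegral_rpow_enorm_toReal (by norm_num) (by norm_num), ENNReal.toReal_ofNat,
        ← ENNReal.rpow_mul]
      norm_num
    rw [h6]
    calc eLpNorm om 6 volume ^ (6 : ℝ) ≤ (K * eLpNorm (fderiv ℝ om) 2 volume) ^ (6 : ℝ) := by gcongr
      _ = ((K : ℝ≥0∞) ^ 2 * eLpNorm (fderiv ℝ om) 2 volume ^ 2) ^ (3 : ℝ) := by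
          rw [← mul_pow, ← ENNReal.rpow_natCast, ← ENNReal.rpow_mul]; norm_num
      _ ≤ ((K : ℝ≥0∞) ^ 2 * ENNReal.ofReal R) ^ (3 : ℝ) := by gcongr
  have hInterp : ∫⁻ x, ‖om x‖ₑ ^ m ≤
      (∫⁻ x, ‖om x‖ₑ ^ (2 : ℝ)) ^ ((6 - m) / (6 - 2)) * (∫⁻ x, ‖om x‖ₑ ^ (6 : ℝ)) ^ ((m - 2) / (6 - 2)) :=
    lintegral_rpow_interpolate cω.aemeasurable.enorm zero_lt_two (by norm_num) h2m.le hm6.le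
  have hθ' : (3 : ℝ) * (1 / (2 * ρ)) = 1 - θ := by rw [hθ]; ring
  have hWm2_le : Wm2 ≤ ENNReal.ofReal a ^ θ * ((K : ℝ≥0∞) ^ 2 * ENNReal.ofReal R) ^ (1 - θ) := by
    rw [hWm2]
    calc (∫⁻ x, ‖om x‖ₑ ^ m) ^ (2 / m)
        ≤ ((∫⁻ x, ‖om x‖ₑ ^ (2 : ℝ)) ^ ((6 - m) / (6 - 2)) *
            (∫⁻ x, ‖om x‖ₑ ^ (6 : ℝ)) ^ ((m - 2) / (6 - 2))) ^ (2 / m) := by gcongr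
      _ = (∫⁻ x, ‖om x‖ₑ ^ (2 : ℝ)) ^ θ * ((∫⁻ x, ‖om x‖ₑ ^ (6 : ℝ)) ^ (1 / (2 * ρ))) := by
          rw [ENNReal.mul_rpow_of_nonneg _ _ (by positivity), ← ENNReal.rpow_mul,
            ← ENNReal.rpow_mul, hexpθ, hexp1]
      _ ≤ (∫⁻ x, ‖om x‖ₑ ^ (2 : ℝ)) ^ θ *
            ((((K : ℝ≥0∞) ^ 2 * ENNReal.ofReal R) ^ (3 : ℝ)) ^ (1 / (2 * ρ))) := by gcongr
      _ = ENNReal.ofReal a ^ θ * ((K : ℝ≥0∞) ^ 2 * ENNReal.ofReal R) ^ (1 - θ) := by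
          rw [hA, ← ENNReal.rpow_mul, hθ']
  -- back to the reals
  have hfin : (Aw : ℝ≥0∞) * ((N₁ : ℝ≥0∞) + N₂) *
      (ENNReal.ofReal a ^ θ * ((K : ℝ≥0∞) ^ 2 * ENNReal.ofReal R) ^ (1 - θ)) ≠ ⊤ := by
    refine ENNReal.mul_ne_top (ENNReal.mul_ne_top ENNReal.coe_ne_top (by simp)) (ENNReal.mul_ne_top ?_ ?_)
    · exact ENNReal.rpow_ne_top_of_nonneg hθ0.le ENNReal.ofReal_ne_top
    · exact ENNReal.rpow_ne_top_of_nonneg h1θ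
        (ENNReal.mul_ne_top (ENNReal.pow_ne_top ENNReal.coe_ne_top) ENNReal.ofReal_ne_top)
  have hgR : ∫ x, g x ≤ ((Aw : ℝ) * ((N₁ : ℝ) + N₂)) * a ^ θ * ((K : ℝ) ^ 2 * R) ^ (1 - θ) := by
    have h1 : ENNReal.ofReal (∫ x, g x) ≤ (Aw : ℝ≥0∞) * ((N₁ : ℝ≥0∞) + N₂) *
        (ENNReal.ofReal a ^ θ * ((K : ℝ≥0∞) ^ 2 * ENNReal.ofReal R) ^ (1 - θ)) :=
      hsum.trans (mul_le_mul' le_rfl hWm2_le)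
    have h2 := (ENNReal.ofReal_le_iff_le_toReal hfin).1 h1
    refine h2.trans_eq ?_
    rw [ENNReal.toReal_mul, ENNReal.toReal_mul, ENNReal.toReal_mul, ← ENNReal.toReal_rpow,
      ← ENNReal.toReal_rpow, ENNReal.toReal_mul, ENNReal.toReal_pow, ENNReal.toReal_ofReal ha0,
      ENNReal.toReal_ofReal hR0, ENNReal.coe_toReal, ENNReal.toReal_add ENNReal.coe_ne_top
      ENNReal.coe_ne_top, ENNReal.coe_toReal, ENNReal.coe_toReal, ENNReal.coe_toReal]
    ring
  -- Young's inequality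
  set Nr : ℝ := (N₁ : ℝ) + N₂ with hNr
  have hNr0 : 0 ≤ Nr := by positivity
  have hAw0 : 0 ≤ (Aw : ℝ) := Aw.2
  have hyoung : ∫ x, g x ≤ ν / 2 * R +
      c₀ * ((Aw : ℝ) * Nr * (K : ℝ) ^ (2 * (1 - θ))) ^ (1 / θ) * a := by
    have hKR : ((K : ℝ) ^ 2 * R) ^ (1 - θ) = (K : ℝ) ^ (2 * (1 - θ)) * R ^ (1 - θ) := by
      rw [Real.mul_rpow (sq_nonneg _) hR0, ← Real.rpow_two, ← Real.rpow_mul (NNReal.coe_nonneg K)]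
    have h1 : ∫ x, g x ≤ ((Aw : ℝ) * Nr * (K : ℝ) ^ (2 * (1 - θ))) * a ^ θ * R ^ (1 - θ) := by
      calc ∫ x, g x ≤ ((Aw : ℝ) * Nr) * a ^ θ * ((K : ℝ) ^ 2 * R) ^ (1 - θ) := hgR
        _ = ((Aw : ℝ) * Nr * (K : ℝ) ^ (2 * (1 - θ))) * a ^ θ * R ^ (1 - θ) := by rw [hKR]; ring
    have h2 := mul_rpow_mul_rpow_le_absorb hθ0 hθ1 hν (a := (Aw : ℝ) * Nr * (K : ℝ) ^ (2 * (1 - θ)))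
      (x := R) (y := a) (by positivity) hR0 ha0
    rw [hc₀]
    linarith [h1, h2]
  -- the constant: `(Aw N K^{2(1-θ)})^{1/θ} = (Aw K^{2(1-θ)})^{1/θ} N^{1/θ}` and convexity
  have hq1 : 1 ≤ 1 / θ := by
    rw [le_div_iff₀ hθ0, one_mul]; exact hθ1.le
  have hsplitN : ((Aw : ℝ) * Nr * (K : ℝ) ^ (2 * (1 - θ))) ^ (1 / θ) =
      ((Aw : ℝ) * (K : ℝ) ^ (2 * (1 - θ))) ^ (1 / θ) * Nr ^ (1 / θ) := by
    rw [show (Aw : ℝ) * Nr * (K : ℝ) ^ (2 * (1 - θ)) = ((Aw : ℝ) * (K : ℝ) ^ (2 * (1 - θ))) * Nr by ring,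
      Real.mul_rpow (by positivity) hNr0]
  have hconv : Nr ^ (1 / θ) ≤ (2 : ℝ) ^ (1 / θ - 1) * ((N₁ : ℝ) ^ (1 / θ) + (N₂ : ℝ) ^ (1 / θ)) := by
    have h := NNReal.rpow_add_le_mul_rpow_add_rpow N₁ N₂ hq1
    have h' := NNReal.coe_le_coe.2 h
    push_cast at h'
    rw [hNr]
    exact h'
  -- conclusion
  have hmain : 2 * ∫ x, g x ≤ ν * R + C * (((N₁ : ℝ) ^ (1 / θ) + (N₂ : ℝ) ^ (1 / θ))) * a := by
    have h3 : c₀ * ((Aw : ℝ) * Nr * (K : ℝ) ^ (2 * (1 - θ))) ^ (1 / θ) * a ≤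
        c₀ * (((Aw : ℝ) * (K : ℝ) ^ (2 * (1 - θ))) ^ (1 / θ) *
          ((2 : ℝ) ^ (1 / θ - 1) * ((N₁ : ℝ) ^ (1 / θ) + (N₂ : ℝ) ^ (1 / θ)))) * a := by
      rw [hsplitN]
      gcongr
    rw [hCdef]
    nlinarith [hyoung, h3, ha0]
  calc 2 * ∫ x, ⟪om x, fderiv ℝ v x (om x)⟫ ≤ 2 * ∫ x, g x := by linarith [hSle]
    _ ≤ ν * R + C * (((N₁ : ℝ) ^ (1 / θ) + (N₂ : ℝ) ^ (1 / θ))) * a := hmain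
    _ = ν * R + C * ((eLpNorm (fun x => om x (k + 1)) γ volume).toReal ^ (1 / θ) +
            (eLpNorm (fun x => om x (k + 2)) γ volume).toReal ^ (1 / θ)) * a := by
        rw [hN₁R, hN₂R]

set_option maxHeartbeats 1600000 in
/-- **Chae–Choe's stretching estimate at the endpoint `γ = 3/2`, small data** (Chae–Choe 1999,
proof of Thm. 1, the case `α = ∞, γ = 3/2`, (10)–(11):
`I₁ ≤ ‖P(ω̃)‖_{3/2}‖ω‖²₆ ≤ C‖ω̃‖_{3/2}‖∇ω‖²₂`, `I₂ ≤ ‖ω̃‖_{3/2}‖P(ω')‖₆‖ω‖₆ ≤ C‖ω̃‖_{3/2}‖∇ω‖²₂`,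
"thus, if `C‖ω̃‖_{L^{∞,3/2}_T} < ν/2`, then we have again `ω ∈ L^∞(0,T;L²) ∩ L²(0,T;H¹)`").
For `ν > 0` and a free index `k` there is `ε = ε(ν) > 0` such that every `C^∞` divergence-free
field `v` on `ℝ³` with `v ∈ L² ∩ L^∞`, `∇v` bounded, `∇v, ∇²v ∈ L²` and
`‖ω_{k+1}‖_{L^{3/2}}, ‖ω_{k+2}‖_{L^{3/2}} ≤ ε` (`ω = curl v`, indices mod `3`) satisfies
`2∫⟪ω, (∇v)ω⟫ ≤ ν ∫|∇ω|²_F` (so that the enstrophy does not increase). Pointwise structure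
`abs_inner_apply_self_le`, Hölder (`3/2`, `3`) and Cauchy–Schwarz, the tree's Calderón–Zygmund
bounds `‖∇v‖₆ ≤ C₁‖ω‖₆` and `‖∂_kv_k‖_{3/2} ≤ C₂(‖ω_{k+1}‖_{3/2} + ‖ω_{k+2}‖_{3/2})` (`L²` tail),
and Sobolev `‖ω‖₆ ≤ K‖∇ω‖₂`; `ε = ν / (4(2C₁ + C₂)K² + 1)`. The constant is not the printed one.
[cite: ChaeChoe1999, Thm. 1 and proof, (10)–(11) (p. 5); MajdaBertozziCUP2002, Ch. 11 (11.9) with Prop. 10.6] -/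
theorem exists_two_mul_integral_stretching_le_of_small_two_components {ν : ℝ} (hν : 0 < ν)
    (k : Fin 3) :
    ∃ ε : ℝ, 0 < ε ∧ ∀ v : EuclideanSpace ℝ (Fin 3) → EuclideanSpace ℝ (Fin 3), ContDiff ℝ ∞ v →
      VectorCalculus.IsDivFree v → eLpNorm v 2 volume < ⊤ → eLpNorm v ⊤ volume < ⊤ →
      ∀ {B₁ : ℝ}, (∀ x, ‖fderiv ℝ v x‖ ≤ B₁) →
      (∫⁻ x, ‖iteratedFDeriv ℝ 1 v x‖ₑ ^ 2 < ⊤) → (∫⁻ x, ‖iteratedFDeriv ℝ 2 v x‖ₑ ^ 2 < ⊤) →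
      eLpNorm (fun x => curl v x (k + 1)) (3 / 2) volume ≤ ENNReal.ofReal ε →
      eLpNorm (fun x => curl v x (k + 2)) (3 / 2) volume ≤ ENNReal.ofReal ε →
        2 * ∫ x, ⟪curl v x, fderiv ℝ v x (curl v x)⟫ ≤
          ν * (∫ x, frobeniusNormSq (fderiv ℝ (curl v) x)) := by
  set e := EuclideanSpace.basisFun (Fin 3) ℝ with he
  have he1 : ∀ i, ‖e i‖ = 1 := fun i => by simp [he]
  set K : ℝ≥0 := SNormLESNormFDerivOfEqConst (EuclideanSpace ℝ (Fin 3))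
    (volume : Measure (EuclideanSpace ℝ (Fin 3))) 2 with hK
  -- the exponent `3/2`
  set γ : ℝ≥0∞ := 3 / 2 with hγdef
  have h1γ : 1 < γ := by
    rw [hγdef, ENNReal.lt_div_iff_mul_lt (Or.inl (by norm_num)) (Or.inl (by norm_num))]
    norm_num
  have hγ0 : γ ≠ 0 := (lt_trans zero_lt_one h1γ).ne'
  have hγ2 : γ ≤ 2 := by
    rw [hγdef]; exact ENNReal.div_le_of_le_mul (by norm_num)
  have hγtop : γ ≠ ⊤ := ne_top_of_le_ne_top (by norm_num) hγ2
  have hγr : γ.toReal = 3 / 2 := by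
    rw [hγdef, ENNReal.toReal_div, ENNReal.toReal_ofNat, ENNReal.toReal_ofNat]
  have hconj : (3 / 2 : ℝ).HolderConjugate 3 := by rw [Real.holderConjugate_iff]; norm_num
  have h22 : (2 : ℝ).HolderConjugate 2 := by rw [Real.holderConjugate_iff]; norm_num
  -- the constants
  have hgap6 : 3 * (1 / (6 : ℝ≥0∞).toReal - 1 / (6 : ℝ≥0∞).toReal) < 1 := by
    rw [sub_self, mul_zero]; exact zero_lt_one
  obtain ⟨C₁, hC₁⟩ := exists_eLpNorm_fderiv_le_curl_of_isDivFree_of_eLpNorm_lt_top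
    (p := 6) (s := 6) (by norm_num) le_rfl (by norm_num) hgap6
  have hgap2 : 3 * (1 / γ.toReal - 1 / (2 : ℝ≥0∞).toReal) < 1 := by
    rw [hγr, ENNReal.toReal_ofNat]; norm_num
  obtain ⟨C₂, hC₂⟩ := exists_eLpNorm_fderiv_apply_le_curl_apply_of_isDivFree_of_eLpNorm_lt_top
    (p := γ) (s := 2) h1γ hγ2 (by norm_num) hgap2
  set Aw : ℝ≥0 := 2 * C₁ + C₂ with hAw
  have hAK0 : 0 ≤ (Aw : ℝ) * (K : ℝ) ^ 2 := by positivity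
  have hden : 0 < 4 * ((Aw : ℝ) * (K : ℝ) ^ 2) + 1 := by positivity
  set ε : ℝ := ν / (4 * ((Aw : ℝ) * (K : ℝ) ^ 2) + 1) with hεdef
  have hε0 : 0 < ε := div_pos hν hden
  have hεkey : 4 * ((Aw : ℝ) * (K : ℝ) ^ 2) * ε ≤ ν := by
    rw [hεdef, ← mul_div_assoc, div_le_iff₀ hden]
    nlinarith [hν, hAK0]
  refine ⟨ε, hε0, ?_⟩
  intro v hv hdiv hv2 hvtop B₁ hB₁ hv1 hv2' hN1 hN2
  -- the vorticity and its regularity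
  have hv3 : ContDiff ℝ 3 v := hv.of_le (by norm_cast)
  have hvm : AEStronglyMeasurable v volume := hv.continuous.aestronglyMeasurable
  set om : EuclideanSpace ℝ (Fin 3) → EuclideanSpace ℝ (Fin 3) := curl v with homdef
  have hom : ContDiff ℝ ∞ om := contDiff_curl (n := ⊤) (hv.of_le (by exact_mod_cast le_top))
  have hom1 : ContDiff ℝ 1 om := hom.of_le (by norm_cast)
  have cω : Continuous om := hom.continuous
  have cDv : Continuous (fderiv ℝ v) := hv.continuous_fderiv (by simp)
  have cωj : ∀ j, Continuous fun x => om x j := fun j => (EuclideanSpace.proj j).continuous.comp cω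
  have cakk : Continuous fun x => fderiv ℝ v x (e k) k :=
    (EuclideanSpace.proj k).continuous.comp (cDv.clm_apply continuous_const)
  have hB₁0 : 0 ≤ B₁ := (norm_nonneg _).trans (hB₁ 0)
  -- `ω, ∇ω ∈ L²`
  set κ : ℝ := ‖curlCLM‖ with hκ
  have l2ω : ∫⁻ x, ‖om x‖ₑ ^ 2 < ⊤ :=
    lt_of_le_of_lt (lintegral_curl_sq_le v) (ENNReal.mul_lt_top ENNReal.ofReal_lt_top hv1)
  have l2Dω : ∫⁻ x, ‖fderiv ℝ om x‖ₑ ^ 2 < ⊤ := by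
    have hle : ∀ x, ‖fderiv ℝ om x‖ ≤ ‖κ • iteratedFDeriv ℝ 2 v x‖ := fun x => by
      rw [norm_smul, Real.norm_of_nonneg (norm_nonneg curlCLM)]
      have h1 : ‖fderiv ℝ om x‖ = ‖iteratedFDeriv ℝ 1 om x‖ := by
        rw [← norm_iteratedFDeriv_fderiv, norm_iteratedFDeriv_zero]
      rw [h1, homdef]
      exact norm_iteratedFDeriv_curl_le_opNorm_mul hv3 1 (by norm_num) x
    refine lintegral_enorm_sq_lt_top_of_norm_le hle ?_
    have h2 : ∫⁻ x, ‖κ • iteratedFDeriv ℝ 2 v x‖ₑ ^ 2 = ‖κ‖ₑ ^ 2 * ∫⁻ x, ‖iteratedFDeriv ℝ 2 v x‖ₑ ^ 2 := by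
      rw [← lintegral_const_mul' _ _ (by simp)]
      exact lintegral_congr fun x => by rw [enorm_smul, mul_pow]
    rw [h2]
    exact ENNReal.mul_lt_top (by simp) hv2'
  -- the real quantity `R = ∫|∇ω|²_F`
  have hRlt : ∫⁻ x, ENNReal.ofReal (frobeniusNormSq (fderiv ℝ om x)) < ⊤ := by
    calc ∫⁻ x, ENNReal.ofReal (frobeniusNormSq (fderiv ℝ om x))
        ≤ ∫⁻ x, 3 * ‖fderiv ℝ om x‖ₑ ^ 2 :=
          lintegral_mono fun x => ofReal_frobeniusNormSq_le_three_mul_enorm_sq _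
      _ = 3 * ∫⁻ x, ‖fderiv ℝ om x‖ₑ ^ 2 := lintegral_const_mul' _ _ (by norm_num)
      _ < ⊤ := ENNReal.mul_lt_top (by norm_num) l2Dω
  have i_R : Integrable (fun x => frobeniusNormSq (fderiv ℝ om x)) volume :=
    integrable_of_continuous_of_nonneg (continuous_frobeniusNormSq_fderiv hom1 (by simp))
      (fun x => frobeniusNormSq_nonneg _) hRlt
  set R : ℝ := ∫ x, frobeniusNormSq (fderiv ℝ om x) with hR
  have hR0 : 0 ≤ R := integral_nonneg fun x => frobeniusNormSq_nonneg _
  have hRE : ENNReal.ofReal R = ∫⁻ x, ENNReal.ofReal (frobeniusNormSq (fderiv ℝ om x)) :=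
    ofReal_integral_eq_lintegral_ofReal i_R (Eventually.of_forall fun x => frobeniusNormSq_nonneg _)
  have hD : eLpNorm (fderiv ℝ om) 2 volume ^ 2 ≤ ENNReal.ofReal R := by
    rw [← lintegral_enorm_sq_eq_eLpNorm_two_sq, hRE]
    refine lintegral_mono fun x => ?_
    rw [← ofReal_norm, ← ENNReal.ofReal_pow (norm_nonneg _)]
    exact ENNReal.ofReal_le_ofReal (sq_opNorm_le_frobeniusNormSq _)
  -- the two controlled vorticity components (finite, and at most `ε`)
  have hN1top : eLpNorm (fun x => om x (k + 1)) γ volume < ⊤ := lt_of_le_of_lt hN1 ENNReal.ofReal_lt_top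
  have hN2top : eLpNorm (fun x => om x (k + 2)) γ volume < ⊤ := lt_of_le_of_lt hN2 ENNReal.ofReal_lt_top
  set N₁ : ℝ≥0 := (eLpNorm (fun x => om x (k + 1)) γ volume).toNNReal with hN₁
  set N₂ : ℝ≥0 := (eLpNorm (fun x => om x (k + 2)) γ volume).toNNReal with hN₂
  have hN₁E : ((N₁ : ℝ≥0) : ℝ≥0∞) = eLpNorm (fun x => om x (k + 1)) γ volume :=
    ENNReal.coe_toNNReal hN1top.ne
  have hN₂E : ((N₂ : ℝ≥0) : ℝ≥0∞) = eLpNorm (fun x => om x (k + 2)) γ volume :=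
    ENNReal.coe_toNNReal hN2top.ne
  have hN₁ε : (N₁ : ℝ) ≤ ε := by
    have h : ((N₁ : ℝ≥0) : ℝ≥0∞) ≤ ENNReal.ofReal ε := by rw [hN₁E]; exact hN1
    rw [← ENNReal.coe_toReal N₁]
    exact (ENNReal.le_ofReal_iff_toReal_le ENNReal.coe_ne_top hε0.le).1 h
  have hN₂ε : (N₂ : ℝ) ≤ ε := by
    have h : ((N₂ : ℝ≥0) : ℝ≥0∞) ≤ ENNReal.ofReal ε := by rw [hN₂E]; exact hN2
    rw [← ENNReal.coe_toReal N₂]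
    exact (ENNReal.le_ofReal_iff_toReal_le ENNReal.coe_ne_top hε0.le).1 h
  -- the pointwise structure bound and the majorant `g`
  set g : EuclideanSpace ℝ (Fin 3) → ℝ := fun x =>
    2 * (|om x (k + 1)| + |om x (k + 2)|) * ‖om x‖ * ‖fderiv ℝ v x‖ +
      ‖om x‖ ^ 2 * |fderiv ℝ v x (e k) k| with hg
  have hg0 : ∀ x, 0 ≤ g x := fun x => by positivity
  have hSg : ∀ x, ⟪om x, fderiv ℝ v x (om x)⟫ ≤ g x := fun x =>
    (le_abs_self _).trans (abs_inner_apply_self_le (om x) (fderiv ℝ v x) k)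
  have hgm : AEStronglyMeasurable g volume :=
    ((((continuous_const.mul (((cωj _).abs).add ((cωj _).abs))).mul cω.norm).mul cDv.norm).add
      ((cω.norm.pow 2).mul cakk.abs)).aestronglyMeasurable
  have i_g : Integrable g volume := by
    have i_a : Integrable (fun x => ‖om x‖ ^ 2) volume := integrable_sq_norm_of_lintegral_lt_top cω l2ω
    have hdom : Integrable (fun x => 5 * B₁ * ‖om x‖ ^ 2) volume := i_a.const_mul _
    refine hdom.mono' hgm (Eventually.of_forall fun x => ?_)
    rw [Real.norm_of_nonneg (hg0 x), hg]
    dsimp only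
    have h1 : |om x (k + 1)| ≤ ‖om x‖ := abs_apply_le_norm_cc _ _
    have h2 : |om x (k + 2)| ≤ ‖om x‖ := abs_apply_le_norm_cc _ _
    have h3 : |fderiv ℝ v x (e k) k| ≤ B₁ := by
      refine (abs_apply_le_norm_cc _ _).trans (((fderiv ℝ v x).le_opNorm _).trans ?_)
      rw [he1, mul_one]; exact hB₁ x
    have h4 : ‖fderiv ℝ v x‖ ≤ B₁ := hB₁ x
    have hw0 : 0 ≤ ‖om x‖ := norm_nonneg _
    calc 2 * (|om x (k + 1)| + |om x (k + 2)|) * ‖om x‖ * ‖fderiv ℝ v x‖ +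
          ‖om x‖ ^ 2 * |fderiv ℝ v x (e k) k|
        ≤ 2 * (‖om x‖ + ‖om x‖) * ‖om x‖ * B₁ + ‖om x‖ ^ 2 * B₁ := by gcongr
      _ = 5 * B₁ * ‖om x‖ ^ 2 := by ring
  have hSle : ∫ x, ⟪om x, fderiv ℝ v x (om x)⟫ ≤ ∫ x, g x := by
    by_cases hS : Integrable (fun x => ⟪om x, fderiv ℝ v x (om x)⟫) volume
    · exact integral_mono hS i_g hSg
    · rw [integral_undef hS]; exact integral_nonneg hg0
  -- `ℝ≥0∞` form of `∫ g`
  set W6 : ℝ≥0∞ := (∫⁻ x, ‖om x‖ₑ ^ (6 : ℝ)) ^ (1 / (6 : ℝ)) with hW6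
  set W62 : ℝ≥0∞ := (∫⁻ x, ‖om x‖ₑ ^ (6 : ℝ)) ^ (1 / (3 : ℝ)) with hW62
  set D6 : ℝ≥0∞ := (∫⁻ x, ‖fderiv ℝ v x‖ₑ ^ (6 : ℝ)) ^ (1 / (6 : ℝ)) with hD6
  have hW6sq : W6 * W6 = W62 := by
    rw [hW6, hW62, ← sq, ← ENNReal.rpow_two, ← ENNReal.rpow_mul]
    congr 1; norm_num
  have hpt : ∀ x, ENNReal.ofReal (g x) =
      2 * (‖om x (k + 1)‖ₑ + ‖om x (k + 2)‖ₑ) * ‖om x‖ₑ * ‖fderiv ℝ v x‖ₑ +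
        ‖om x‖ₑ ^ (2 : ℝ) * ‖fderiv ℝ v x (e k) k‖ₑ := by
    intro x
    rw [hg]
    dsimp only
    have hs0 : 0 ≤ |om x (k + 1)| + |om x (k + 2)| := by positivity
    rw [ENNReal.ofReal_add (by positivity) (by positivity),
      ENNReal.ofReal_mul (by positivity : 0 ≤ 2 * (|om x (k + 1)| + |om x (k + 2)|) * ‖om x‖),
      ENNReal.ofReal_mul (by positivity : 0 ≤ 2 * (|om x (k + 1)| + |om x (k + 2)|)),
      ENNReal.ofReal_mul (by norm_num : (0 : ℝ) ≤ 2), ENNReal.ofReal_add (abs_nonneg _) (abs_nonneg _),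
      ENNReal.ofReal_mul (sq_nonneg _), ENNReal.ofReal_pow (norm_nonneg _), ENNReal.ofReal_ofNat]
    simp only [ofReal_norm, ← Real.enorm_eq_ofReal_abs, ENNReal.rpow_two]
  have mω : AEMeasurable (fun x => ‖om x‖ₑ) volume := cω.aemeasurable.enorm
  have mDv : AEMeasurable (fun x => ‖fderiv ℝ v x‖ₑ) volume := cDv.aemeasurable.enorm
  have mωj : ∀ j, AEMeasurable (fun x => ‖om x j‖ₑ) volume := fun j => (cωj j).aemeasurable.enorm
  have makk : AEMeasurable (fun x => ‖fderiv ℝ v x (e k) k‖ₑ) volume := cakk.aemeasurable.enorm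
  -- Cauchy–Schwarz: `‖ |ω| |Dv| ‖₃ ≤ ‖ω‖₆ ‖Dv‖₆`
  have hCS : (∫⁻ x, (‖om x‖ₑ * ‖fderiv ℝ v x‖ₑ) ^ (3 : ℝ)) ^ (1 / (3 : ℝ)) ≤ W6 * D6 := by
    have hmul : ∀ x, (‖om x‖ₑ * ‖fderiv ℝ v x‖ₑ) ^ (3 : ℝ) =
        ‖om x‖ₑ ^ (3 : ℝ) * ‖fderiv ℝ v x‖ₑ ^ (3 : ℝ) := fun x =>
      ENNReal.mul_rpow_of_nonneg _ _ (by norm_num)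
    have hpow : ∀ y : ℝ≥0∞, (y ^ (3 : ℝ)) ^ (2 : ℝ) = y ^ (6 : ℝ) := fun y => by
      rw [← ENNReal.rpow_mul]; norm_num
    have hcs := ENNReal.lintegral_mul_le_Lp_mul_Lq volume h22
      (f := fun x => ‖om x‖ₑ ^ (3 : ℝ)) (g := fun x => ‖fderiv ℝ v x‖ₑ ^ (3 : ℝ))
      (mω.pow_const _) (mDv.pow_const _)
    simp only [Pi.mul_apply, hpow] at hcs
    calc (∫⁻ x, (‖om x‖ₑ * ‖fderiv ℝ v x‖ₑ) ^ (3 : ℝ)) ^ (1 / (3 : ℝ))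
        = (∫⁻ x, ‖om x‖ₑ ^ (3 : ℝ) * ‖fderiv ℝ v x‖ₑ ^ (3 : ℝ)) ^ (1 / (3 : ℝ)) := by
          rw [lintegral_congr fun x => hmul x]
      _ ≤ ((∫⁻ x, ‖om x‖ₑ ^ (6 : ℝ)) ^ (1 / (2 : ℝ)) *
            (∫⁻ x, ‖fderiv ℝ v x‖ₑ ^ (6 : ℝ)) ^ (1 / (2 : ℝ))) ^ (1 / (3 : ℝ)) := by
          gcongr
      _ = W6 * D6 := by
          rw [ENNReal.mul_rpow_of_nonneg _ _ (by positivity), ← ENNReal.rpow_mul, ← ENNReal.rpow_mul,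
            hW6, hD6]
          congr 2 <;> norm_num
  -- Hölder (`3/2`, `3`) for the off-diagonal group: `∫ |ω_j| |ω| |Dv| ≤ ‖ω_j‖_{3/2} ‖ω‖₆ ‖Dv‖₆`
  have hT1 : ∀ j, ∫⁻ x, ‖om x j‖ₑ * (‖om x‖ₑ * ‖fderiv ℝ v x‖ₑ) ≤
      eLpNorm (fun x => om x j) γ volume * (W6 * D6) := by
    intro j
    have h := ENNReal.lintegral_mul_le_Lp_mul_Lq volume hconj (f := fun x => ‖om x j‖ₑ)
      (g := fun x => ‖om x‖ₑ * ‖fderiv ℝ v x‖ₑ) (mωj j) (mω.mul mDv)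
    simp only [Pi.mul_apply] at h
    have hf : (∫⁻ x, ‖om x j‖ₑ ^ (3 / 2 : ℝ)) ^ (1 / (3 / 2 : ℝ)) = eLpNorm (fun x => om x j) γ volume := by
      rw [eLpNorm_eq_lintegral_rpow_enorm_toReal hγ0 hγtop, hγr]
    rw [hf] at h
    exact h.trans (mul_le_mul' le_rfl hCS)
  -- Hölder (`3/2`, `3`) for the diagonal term: `∫ |∂_kv_k| |ω|² ≤ ‖∂_kv_k‖_{3/2} ‖ω‖₆²`
  have hT2 : ∫⁻ x, ‖om x‖ₑ ^ (2 : ℝ) * ‖fderiv ℝ v x (e k) k‖ₑ ≤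
      eLpNorm (fun x => fderiv ℝ v x (e k) k) γ volume * W62 := by
    have h := ENNReal.lintegral_mul_le_Lp_mul_Lq volume hconj
      (f := fun x => ‖fderiv ℝ v x (e k) k‖ₑ) (g := fun x => ‖om x‖ₑ ^ (2 : ℝ))
      makk (mω.pow_const _)
    have hgm' : ∀ x, (‖om x‖ₑ ^ (2 : ℝ)) ^ (3 : ℝ) = ‖om x‖ₑ ^ (6 : ℝ) := fun x => by
      rw [← ENNReal.rpow_mul]; norm_num
    simp only [Pi.mul_apply, hgm'] at h
    have hf : (∫⁻ x, ‖fderiv ℝ v x (e k) k‖ₑ ^ (3 / 2 : ℝ)) ^ (1 / (3 / 2 : ℝ)) =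
        eLpNorm (fun x => fderiv ℝ v x (e k) k) γ volume := by
      rw [eLpNorm_eq_lintegral_rpow_enorm_toReal hγ0 hγtop, hγr]
    rw [hf] at h
    calc ∫⁻ x, ‖om x‖ₑ ^ (2 : ℝ) * ‖fderiv ℝ v x (e k) k‖ₑ
        = ∫⁻ x, ‖fderiv ℝ v x (e k) k‖ₑ * ‖om x‖ₑ ^ (2 : ℝ) := lintegral_congr fun x => mul_comm _ _
      _ ≤ _ := h
  -- the Calderón–Zygmund inputs
  have hv6 : eLpNorm v 6 volume < ⊤ :=
    (memLp_of_memLp_of_memLp_top (p := 2) (q := 6) (by norm_num) (by norm_num) ⟨hvm, hv2⟩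
      ⟨hvm, hvtop⟩).eLpNorm_lt_top
  have hD6_le : D6 ≤ C₁ * W6 := by
    have h := hC₁ v hv hdiv hv6
    rw [eLpNorm_eq_lintegral_rpow_enorm_toReal (by norm_num) (by norm_num),
      eLpNorm_eq_lintegral_rpow_enorm_toReal (by norm_num) (by norm_num), ENNReal.toReal_ofNat,
      ← homdef] at h
    exact h
  have hrow : eLpNorm (fun x => fderiv ℝ v x (e k) k) γ volume ≤ C₂ * ((N₁ : ℝ≥0∞) + N₂) := by
    have h := hC₂ v hv hdiv hv2 (e k) (he1 k).le k
    rw [← homdef] at h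
    rw [hN₁E, hN₂E]
    exact h
  -- the bound for `∫ g` in `ℝ≥0∞`
  have hsum : ENNReal.ofReal (∫ x, g x) ≤ (Aw : ℝ≥0∞) * ((N₁ : ℝ≥0∞) + N₂) * W62 := by
    rw [ofReal_integral_eq_lintegral_ofReal i_g (Eventually.of_forall hg0)]
    have hsplit : ∀ x, ENNReal.ofReal (g x) =
        2 * (‖om x (k + 1)‖ₑ * (‖om x‖ₑ * ‖fderiv ℝ v x‖ₑ)) +
          2 * (‖om x (k + 2)‖ₑ * (‖om x‖ₑ * ‖fderiv ℝ v x‖ₑ)) +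
          ‖om x‖ₑ ^ (2 : ℝ) * ‖fderiv ℝ v x (e k) k‖ₑ := fun x => by
      rw [hpt x]; ring
    have m1 : AEMeasurable (fun x => 2 * (‖om x (k + 1)‖ₑ * (‖om x‖ₑ * ‖fderiv ℝ v x‖ₑ))) volume :=
      ((mωj _).mul (mω.mul mDv)).const_mul _
    have m2 : AEMeasurable (fun x => 2 * (‖om x (k + 2)‖ₑ * (‖om x‖ₑ * ‖fderiv ℝ v x‖ₑ))) volume :=
      ((mωj _).mul (mω.mul mDv)).const_mul _
    calc ∫⁻ x, ENNReal.ofReal (g x)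
        = ∫⁻ x, (2 * (‖om x (k + 1)‖ₑ * (‖om x‖ₑ * ‖fderiv ℝ v x‖ₑ)) +
            2 * (‖om x (k + 2)‖ₑ * (‖om x‖ₑ * ‖fderiv ℝ v x‖ₑ)) +
            ‖om x‖ₑ ^ (2 : ℝ) * ‖fderiv ℝ v x (e k) k‖ₑ) := lintegral_congr hsplit
      _ = 2 * (∫⁻ x, ‖om x (k + 1)‖ₑ * (‖om x‖ₑ * ‖fderiv ℝ v x‖ₑ)) +
            2 * (∫⁻ x, ‖om x (k + 2)‖ₑ * (‖om x‖ₑ * ‖fderiv ℝ v x‖ₑ)) +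
            ∫⁻ x, ‖om x‖ₑ ^ (2 : ℝ) * ‖fderiv ℝ v x (e k) k‖ₑ := by
          have m12 : AEMeasurable (fun x => 2 * (‖om x (k + 1)‖ₑ * (‖om x‖ₑ * ‖fderiv ℝ v x‖ₑ)) +
              2 * (‖om x (k + 2)‖ₑ * (‖om x‖ₑ * ‖fderiv ℝ v x‖ₑ))) volume := m1.add m2
          rw [lintegral_add_left' m12, lintegral_add_left' m1,
            lintegral_const_mul' 2 _ (by norm_num), lintegral_const_mul' 2 _ (by norm_num)]
      _ ≤ 2 * ((N₁ : ℝ≥0∞) * (W6 * D6)) + 2 * ((N₂ : ℝ≥0∞) * (W6 * D6)) +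
            C₂ * ((N₁ : ℝ≥0∞) + N₂) * W62 := by
          have h1' := hT1 (k + 1)
          have h2' := hT1 (k + 2)
          rw [← hN₁E] at h1'
          rw [← hN₂E] at h2'
          exact add_le_add (add_le_add (mul_le_mul' le_rfl h1') (mul_le_mul' le_rfl h2'))
            (hT2.trans (mul_le_mul' hrow le_rfl))
      _ ≤ 2 * ((N₁ : ℝ≥0∞) * (W6 * (C₁ * W6))) + 2 * ((N₂ : ℝ≥0∞) * (W6 * (C₁ * W6))) +
            C₂ * ((N₁ : ℝ≥0∞) + N₂) * W62 :=
          add_le_add (add_le_add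
            (mul_le_mul' le_rfl (mul_le_mul' le_rfl (mul_le_mul' le_rfl hD6_le)))
            (mul_le_mul' le_rfl (mul_le_mul' le_rfl (mul_le_mul' le_rfl hD6_le)))) le_rfl
      _ = (Aw : ℝ≥0∞) * ((N₁ : ℝ≥0∞) + N₂) * W62 := by
          rw [hAw, ← hW6sq]; push_cast; ring
  -- Sobolev: `‖ω‖₆² ≤ K² ∫|∇ω|²_F`
  have hS : eLpNorm om 6 volume ≤ K * eLpNorm (fderiv ℝ om) 2 volume :=
    eLpNorm_six_le_eLpNorm_fderiv_two volume finrank_euclideanSpace_fin hom1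
      (eLpNorm_two_lt_top_of_lintegral_enorm_sq_lt_top l2ω)
  have h6 : W62 = eLpNorm om 6 volume ^ 2 := by
    rw [hW62, eLpNorm_eq_lintegral_rpow_enorm_toReal (by norm_num) (by norm_num), ENNReal.toReal_ofNat,
      ← ENNReal.rpow_natCast, ← ENNReal.rpow_mul]
    congr 1; norm_num
  have hW62_le : W62 ≤ (K : ℝ≥0∞) ^ 2 * ENNReal.ofReal R := by
    rw [h6]
    calc eLpNorm om 6 volume ^ 2 ≤ (K * eLpNorm (fderiv ℝ om) 2 volume) ^ 2 := by gcongr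
      _ = (K : ℝ≥0∞) ^ 2 * eLpNorm (fderiv ℝ om) 2 volume ^ 2 := mul_pow _ _ _
      _ ≤ (K : ℝ≥0∞) ^ 2 * ENNReal.ofReal R := by gcongr
  -- back to the reals
  have hfin : (Aw : ℝ≥0∞) * ((N₁ : ℝ≥0∞) + N₂) * ((K : ℝ≥0∞) ^ 2 * ENNReal.ofReal R) ≠ ⊤ :=
    ENNReal.mul_ne_top (ENNReal.mul_ne_top ENNReal.coe_ne_top (by simp))
      (ENNReal.mul_ne_top (ENNReal.pow_ne_top ENNReal.coe_ne_top) ENNReal.ofReal_ne_top)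
  have hgR : ∫ x, g x ≤ ((Aw : ℝ) * ((N₁ : ℝ) + N₂)) * ((K : ℝ) ^ 2 * R) := by
    have h1 : ENNReal.ofReal (∫ x, g x) ≤
        (Aw : ℝ≥0∞) * ((N₁ : ℝ≥0∞) + N₂) * ((K : ℝ≥0∞) ^ 2 * ENNReal.ofReal R) :=
      hsum.trans (mul_le_mul' le_rfl hW62_le)
    have h2 := (ENNReal.ofReal_le_iff_le_toReal hfin).1 h1
    refine h2.trans_eq ?_
    rw [ENNReal.toReal_mul, ENNReal.toReal_mul, ENNReal.toReal_mul, ENNReal.toReal_pow,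
      ENNReal.toReal_ofReal hR0, ENNReal.coe_toReal, ENNReal.toReal_add ENNReal.coe_ne_top
      ENNReal.coe_ne_top, ENNReal.coe_toReal, ENNReal.coe_toReal, ENNReal.coe_toReal]
  -- conclusion
  have hNN : (N₁ : ℝ) + N₂ ≤ 2 * ε := by linarith
  calc 2 * ∫ x, ⟪om x, fderiv ℝ v x (om x)⟫ ≤ 2 * ∫ x, g x := by linarith [hSle]
    _ ≤ 2 * (((Aw : ℝ) * ((N₁ : ℝ) + N₂)) * ((K : ℝ) ^ 2 * R)) := by linarith [hgR]
    _ = (2 * ((Aw : ℝ) * (K : ℝ) ^ 2) * ((N₁ : ℝ) + N₂)) * R := by ring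
    _ ≤ (2 * ((Aw : ℝ) * (K : ℝ) ^ 2) * (2 * ε)) * R := by gcongr
    _ = (4 * ((Aw : ℝ) * (K : ℝ) ^ 2) * ε) * R := by ring
    _ ≤ ν * R := mul_le_mul_of_nonneg_right hεkey hR0

end Estimate

end Literature.Analysis.FluidPDE
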